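import Mathlib.Tactic
import HarnessLib
import Summits.CriticalPhenomena.PercolationContinuityZ3.Theorems.PercNearOneGluingNoHeavyLowerTailKnQuestion8UnifTwoW0

/-!
# Kozma–Nitzan's Question 8 at three relays — the universal k = 2 step of the uniform form (gen 31)

Support file (`--supports stmt-CriticalPhenomena-4575`, closed crux; independent mathematics on Kozma–Nitzan's Question 8,
arXiv:2401.12397 §5.5 p. 36), prover `prim-ineq-gen-6` (gen 31).  No definitions, no named facts, no sorries; standard axioms.
Memo `run/shared/lean/prim/prim-ineq-gen-6/FINDING-G31.md` §5b–§5c.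

The reduced k = 2 problem (RC-G): in vertex-1 / T₂-channel coordinates (A, C = marks of vertex 1, s = weight of e₂, ω = 1−s,
λ′ = (1+λ)C − 1 ≥ 0, depth-0 weight w ≤ 1−λ; T₂ summarised by its channels u, v, m and defect T′ with u+v+m+T′ = 1, subject to
the three structural facts v ≥ λ′m, T′ ≥ λ′u, T′m ≥ uv) the merge step (M‴) at k = 2 reads NEEDS ≤ KILLS with
NEEDS = N1 + N3 and KILLS = Ka + Kb + R₁′ + LL′ + HY (FINDING-G31 §5).  Everything is multiplied by the positive normaliser
p·p₀·ω·A.  `claimZ` is the far-factor inequality for the cut class; `k2_wpart_core` is the depth-0 chain; `rcg_k2_caseAC`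
(A ≥ C, uses `k2_w0_core` of the W0 file) and `rcg_k2_caseCA` (A ≤ C) assemble the step.  With `merge_induction` (the base
case k = 1 being `λu₁ ≤ δ₁u₁ ≤ T`) this is the universal form of THEOREM NX′₂: w·x₀ + X₁ ≤ 0 for EVERY block at a crossing
k = 2, every λ ∈ (0,1) and every depth-0 weight w ∈ [0, 1−λ].
[cite: KozmaNitzan2024, Question 8 (§5.5 p. 36)]
-/

namespace Summit.CriticalPhenomena.PercolationContinuityZ3.Theorems

namespace PocketCert


/-- **CLAIM Z (far-factor bound for the cut class).**  With `p = u+v+m ≤ 1`, `q = (1−s)p + sm`, `M₁ = A + C − AC`,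
`p₀ = M₁q + sCu + sAv` (the far factor of `T₁`), `B_p = (1−C)q + sv` (`= v₁/A`), `B′ = (1−C)((1−s)+sm) + sv`, marks in `(0,1]`
with `C ≥ ½` (vertex 1 not crossed, λ < 1), `0 ≤ s ≤ 1`:   `A²·p·B_p ≤ A·p₀·B′ + ¾·p₀`.
Proof: `Ap = p₀ − C(1−A)q + s(A−C)u` and `s(A−C)⁺u·A·B_p ≤ [(1−C)² + (1−C)]·p₀ ≤ ¾p₀`.
[cite: KozmaNitzan2024, Question 8 (§5.5 p. 36)] -/
theorem claimZ (A C s u v m p q M₁ p₀ Bp Bq : ℝ) (hA0 : 0 < A) (hA1 : A ≤ 1) (hC0 : 1 / 2 ≤ C) (hC1 : C ≤ 1)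
    (hs0 : 0 ≤ s) (hs1 : s ≤ 1) (hu : 0 ≤ u) (hv : 0 ≤ v) (hm : 0 ≤ m) (hp : p = u + v + m) (hp1 : p ≤ 1)
    (hq : q = (1 - s) * p + s * m) (hM : M₁ = A + C - A * C) (hp0 : p₀ = M₁ * q + s * C * u + s * A * v)
    (hBp : Bp = (1 - C) * q + s * v) (hBq : Bq = (1 - C) * ((1 - s) + s * m) + s * v) :
    A ^ 2 * p * Bp ≤ A * p₀ * Bq + 3 / 4 * p₀ := by
  have hp0' : 0 ≤ p := by rw [hp]; linarith
  have hom : 0 ≤ 1 - s := by linarith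
  have h1C : 0 ≤ 1 - C := by linarith
  have hCpos : 0 ≤ C := by linarith
  have h1A : 0 ≤ 1 - A := by linarith
  have hAC1 : 0 ≤ A * (1 - C) := mul_nonneg hA0.le h1C
  have hM0 : 0 ≤ M₁ := by rw [hM]; linarith [hAC1]
  have hMA : A ≤ M₁ := by
    rw [hM]; have : 0 ≤ C * (1 - A) := mul_nonneg hCpos h1A; linarith
  have hq0 : 0 ≤ q := by rw [hq]; positivity
  have hq1 : q ≤ (1 - s) + s * m := by
    rw [hq]; have : (1 - s) * p ≤ (1 - s) * 1 := mul_le_mul_of_nonneg_left hp1 hom; linarith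
  have hBp0 : 0 ≤ Bp := by rw [hBp]; positivity
  have hBpq : Bp ≤ Bq := by
    rw [hBp, hBq]; have := mul_le_mul_of_nonneg_left hq1 h1C; linarith
  have hsv : 0 ≤ s * A * v := by positivity
  have hsu : 0 ≤ s * C * u := by positivity
  have hMq : 0 ≤ M₁ * q := mul_nonneg hM0 hq0
  have hP2 : s * A * v ≤ p₀ := by rw [hp0]; linarith
  have hP0 : 0 ≤ p₀ := le_trans hsv hP2
  have hAq : A * q ≤ p₀ := by
    have : A * q ≤ M₁ * q := mul_le_mul_of_nonneg_right hMA hq0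
    rw [hp0]; linarith
  -- identity  A p = p₀ - C(1-A) q + s (A - C) u
  have hid : A * p = p₀ - C * (1 - A) * q + s * (A - C) * u := by
    rw [hp0, hq, hM, hp]; ring
  have hABp : 0 ≤ A * Bp := mul_nonneg hA0.le hBp0
  -- step 1 :  A²pBp = A Bp (A p) = A Bp p₀ - A Bp C(1-A) q + A Bp s(A-C)u
  have hstep1 : A ^ 2 * p * Bp ≤ A * p₀ * Bq + A * Bp * (s * (A - C) * u) := by
    have e : A ^ 2 * p * Bp = A * Bp * p₀ - A * Bp * (C * (1 - A) * q) + A * Bp * (s * (A - C) * u) := by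
      have e0 : A ^ 2 * p * Bp = A * Bp * (A * p) := by ring
      rw [e0, hid]; ring
    have t1 : A * Bp * p₀ ≤ A * p₀ * Bq := by
      have := mul_le_mul_of_nonneg_left hBpq (mul_nonneg hA0.le hP0)
      have e2 : A * p₀ * Bp = A * Bp * p₀ := by ring
      linarith [this, e2]
    have t2 : 0 ≤ A * Bp * (C * (1 - A) * q) := by positivity
    linarith [e, t1, t2]
  -- remainder ≤ 3/4 p₀
  have hrem : A * Bp * (s * (A - C) * u) ≤ 3 / 4 * p₀ := by
    rcases le_or_gt A C with hAC | hCA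
    · have h0 : s * (A - C) * u ≤ 0 := by
        have e : s * (A - C) * u = -((s * u) * (C - A)) := by ring
        have : 0 ≤ (s * u) * (C - A) := mul_nonneg (mul_nonneg hs0 hu) (by linarith)
        linarith
      have : A * Bp * (s * (A - C) * u) ≤ 0 := mul_nonpos_of_nonneg_of_nonpos hABp h0
      linarith
    · have hx : 0 ≤ (s * u) * (A - C) := mul_nonneg (mul_nonneg hs0 hu) (by linarith)
      have hsu1 : s * u ≤ 1 := by
        have : s * u ≤ 1 * u := mul_le_mul_of_nonneg_right hs1 hu
        have hu1 : u ≤ 1 := by linarith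
        linarith
      have hx1 : (s * u) * (A - C) ≤ 1 - C := by
        calc (s * u) * (A - C) ≤ 1 * (A - C) := mul_le_mul_of_nonneg_right hsu1 (by linarith)
          _ ≤ 1 - C := by linarith
      have e : A * Bp * (s * (A - C) * u)
          = ((s * u) * (A - C)) * ((1 - C) * (A * q)) + ((s * u) * (A - C)) * (s * A * v) := by
        rw [hBp]; ring
      have i2 : 0 ≤ (1 - C) * (A * q) := by positivity
      have b1 : ((s * u) * (A - C)) * ((1 - C) * (A * q)) ≤ (1 - C) * ((1 - C) * p₀) :=
        calc ((s * u) * (A - C)) * ((1 - C) * (A * q)) ≤ (1 - C) * ((1 - C) * (A * q)) :=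
              mul_le_mul_of_nonneg_right hx1 i2
          _ ≤ (1 - C) * ((1 - C) * p₀) :=
              mul_le_mul_of_nonneg_left (mul_le_mul_of_nonneg_left hAq h1C) h1C
      have b2 : ((s * u) * (A - C)) * (s * A * v) ≤ (1 - C) * p₀ :=
        calc ((s * u) * (A - C)) * (s * A * v) ≤ (1 - C) * (s * A * v) := mul_le_mul_of_nonneg_right hx1 hsv
          _ ≤ (1 - C) * p₀ := mul_le_mul_of_nonneg_left hP2 h1C
      have hd2 : (1 - C) ≤ 1 / 2 := by linarith
      have hdd : (1 - C) * (1 - C) + (1 - C) ≤ 3 / 4 := by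
        have : (1 - C) * (1 - C) ≤ (1 / 2) * (1 - C) := mul_le_mul_of_nonneg_right hd2 h1C
        linarith
      have f := mul_le_mul_of_nonneg_right hdd hP0
      have e2 : ((1 - C) * (1 - C) + (1 - C)) * p₀ = (1 - C) * ((1 - C) * p₀) + (1 - C) * p₀ := by ring
      linarith [e, b1, b2, f, e2]
  linarith [hstep1, hrem]

/-- **The depth-0 ('cut class') chain of the k = 2 step.**  With `T′ ≥ λ′u`, `v ≥ λ′m`, `u+v+m+T′ = 1`, `s·Yabs ≥ 0`
and `K₀ = λC(1−A) + M₁ ≥ (1−A)(1+λ)C`:  `ω[(1−A)λ′ − T′K₀] − s·Yabs ≤ ω(1−A)(1+λ)C·v`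
(write `λ′ = λ′(u+v+m+T′)`, pair `u, T′` with the `T′K₀` credit and `m` with `v`).
[cite: KozmaNitzan2024, Question 8 (§5.5 p. 36)] -/
theorem k2_wpart_core (lam A C s u v m T' Yabs : ℝ) (hA0 : 0 ≤ A) (hA1 : A ≤ 1)
    (hs1 : s ≤ 1) (hsY : 0 ≤ s * Yabs) (hT : 0 ≤ T')
    (hsum : u + v + m + T' = 1) (hTu : ((1 + lam) * C - 1) * u ≤ T') (hvm : ((1 + lam) * C - 1) * m ≤ v) :
    (1 - s) * ((1 - A) * ((1 + lam) * C - 1) - T' * (lam * C * (1 - A) + (A + C - A * C))) - s * Yabs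
      ≤ (1 - s) * (1 - A) * (1 + lam) * C * v := by
  set lp := (1 + lam) * C - 1 with hlpd
  have hom : 0 ≤ 1 - s := by linarith
  have h1A : 0 ≤ 1 - A := by linarith
  have e1 : (1 - A) * lp = (1 - A) * lp * (u + T') + (1 - A) * lp * (v + m) := by
    have : u + T' + (v + m) = 1 := by linarith
    calc (1 - A) * lp = (1 - A) * lp * (u + T' + (v + m)) := by rw [this, mul_one]
      _ = _ := by ring
  have h2 : (1 - A) * lp * (u + T') ≤ T' * (lam * C * (1 - A) + (A + C - A * C)) := by
    have a1 : lp * (u + T') ≤ T' * (1 + lp) := by nlinarith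
    have a2 := mul_le_mul_of_nonneg_left a1 h1A
    have a3 : (1 - A) * (T' * (1 + lp)) = T' * ((1 - A) * (1 + lam) * C) := by rw [hlpd]; ring
    have a4 : (1 - A) * (1 + lam) * C ≤ lam * C * (1 - A) + (A + C - A * C) := by nlinarith
    have a5 := mul_le_mul_of_nonneg_left a4 hT
    calc (1 - A) * lp * (u + T') = (1 - A) * (lp * (u + T')) := by ring
      _ ≤ (1 - A) * (T' * (1 + lp)) := a2
      _ = T' * ((1 - A) * (1 + lam) * C) := a3
      _ ≤ T' * (lam * C * (1 - A) + (A + C - A * C)) := a5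
  have h3 : (1 - A) * lp * (v + m) ≤ (1 - A) * (1 + lam) * C * v := by
    have b1 : lp * (v + m) ≤ lp * v + v := by nlinarith
    have b2 : lp * v + v = (1 + lam) * C * v := by rw [hlpd]; ring
    have := mul_le_mul_of_nonneg_left b1 h1A
    calc (1 - A) * lp * (v + m) = (1 - A) * (lp * (v + m)) := by ring
      _ ≤ (1 - A) * (lp * v + v) := this
      _ = (1 - A) * (1 + lam) * C * v := by rw [b2]; ring
  have h4 : (1 - A) * lp - T' * (lam * C * (1 - A) + (A + C - A * C)) ≤ (1 - A) * (1 + lam) * C * v := by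
    linarith [e1, h2, h3]
  have h5 := mul_le_mul_of_nonneg_left h4 hom
  have : (1 - s) * ((1 - A) * (1 + lam) * C * v) = (1 - s) * (1 - A) * (1 + lam) * C * v := by ring
  linarith [h5, hsY, this]


/-- **Depth-1 part of (RC-G) (A ≥ C), scaled by p·p₀·ω·A.**  `N3s ≤ Kb1s + LLs` where `Kb1s = C·v·[(ωM₁+s)T′ − sλ′u]·(p₀ωA)`
is the part of `Kbs` used, from `k2_w0_core` (m > 0) or trivially (m = 0 forces uv = 0).
[cite: KozmaNitzan2024, Question 8 (§5.5 p. 36)] -/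
theorem rcg_k2_depth1 (lam A C s u v m T' p q M₁ p₀ m₁ : ℝ)
    (hl0 : 0 < lam) (hl1 : lam < 1) (hC0 : 0 < C) (hCA : C ≤ A) (hA1 : A ≤ 1) (hlp : 0 ≤ (1 + lam) * C - 1)
    (hs0 : 0 ≤ s) (hs1 : s < 1) (hu : 0 ≤ u) (hv : 0 ≤ v) (hm : 0 ≤ m) (hT : 0 ≤ T')
    (hTu : ((1 + lam) * C - 1) * u ≤ T') (hvm : ((1 + lam) * C - 1) * m ≤ v) (hcheb : u * v ≤ T' * m)
    (hp : p = u + v + m) (hq : q = (1 - s) * p + s * m) (hM : M₁ = A + C - A * C)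
    (hp0 : p₀ = M₁ * q + s * C * u + s * A * v) (hm1 : m₁ = A * C * q) :
    C * v * s * lam * (A - C) * u * (p₀ * (1 - s) * A)
      ≤ C * v * (((1 - s) * M₁ + s) * T' - s * ((1 + lam) * C - 1) * u) * (p₀ * (1 - s) * A)
        + (1 - C) * lam ^ 2 * m₁ * u * (p₀ * (1 - s) * A) := by
  have hA0 : 0 < A := lt_of_lt_of_le hC0 hCA
  have hC1 : C ≤ 1 := le_trans hCA hA1
  have hom : 0 < 1 - s := by linarith
  have h1C : 0 ≤ 1 - C := by linarith
  have hp0' : 0 ≤ p := by rw [hp]; linarith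
  have hq0 : 0 ≤ q := by rw [hq]; positivity
  have hAC : 0 ≤ A * C := mul_nonneg hA0.le hC0.le
  have hM0 : 0 ≤ M₁ := by
    rw [hM]; have : 0 ≤ C * (1 - A) := mul_nonneg hC0.le (by linarith); linarith
  have hP0 : 0 ≤ p₀ := by rw [hp0]; positivity
  have hw0core : s * lam * (A - C) * u * v
      ≤ v * (((1 - s) * M₁ + s) * T' - s * ((1 + lam) * C - 1) * u) + (1 - C) * lam ^ 2 * A * s * m * u := by
    rcases lt_or_eq_of_le hm with hmpos | hmz
    · exact k2_w0_core lam A C s M₁ u v m T' hl0 hl1 hC0 hCA hA1 hlp hs0 hs1.le hM0 hu hv hmpos hcheb hvm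
    · have huv0 : u * v ≤ 0 := by rw [← hmz] at hcheb; simpa using hcheb
      have huv : u * v = 0 := le_antisymm huv0 (mul_nonneg hu hv)
      have l0 : s * lam * (A - C) * u * v = 0 := by
        have : s * lam * (A - C) * u * v = s * lam * (A - C) * (u * v) := by ring
        rw [this, huv, mul_zero]
      have t1 : s * (((1 + lam) * C - 1) * u) ≤ s * T' := mul_le_mul_of_nonneg_left hTu hs0
      have t2 : 0 ≤ (1 - s) * M₁ * T' := by positivity
      have r0 : 0 ≤ ((1 - s) * M₁ + s) * T' - s * ((1 + lam) * C - 1) * u := by nlinarith [t1, t2]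
      have r0' : 0 ≤ v * (((1 - s) * M₁ + s) * T' - s * ((1 + lam) * C - 1) * u) := mul_nonneg hv r0
      have r1 : 0 ≤ (1 - C) * lam ^ 2 * A * s * m * u := by positivity
      linarith
  have hm1' : A * C * s * m ≤ m₁ := by
    rw [hm1, hq]
    have : 0 ≤ A * C * ((1 - s) * p) := by positivity
    nlinarith [this]
  have hscale : 0 ≤ C * (p₀ * (1 - s) * A) := by positivity
  have t := mul_le_mul_of_nonneg_right hw0core hscale
  have e1 : s * lam * (A - C) * u * v * (C * (p₀ * (1 - s) * A)) = C * v * s * lam * (A - C) * u * (p₀ * (1 - s) * A) := by ring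
  have e2 : (v * (((1 - s) * M₁ + s) * T' - s * ((1 + lam) * C - 1) * u) + (1 - C) * lam ^ 2 * A * s * m * u) * (C * (p₀ * (1 - s) * A))
      = C * v * (((1 - s) * M₁ + s) * T' - s * ((1 + lam) * C - 1) * u) * (p₀ * (1 - s) * A)
        + ((1 - C) * lam ^ 2) * (A * C * s * m) * (u * (p₀ * (1 - s) * A)) := by ring
  have c0 : 0 ≤ (1 - C) * lam ^ 2 := by positivity
  have c1 : 0 ≤ u * (p₀ * (1 - s) * A) := by positivity
  have t2 : ((1 - C) * lam ^ 2) * (A * C * s * m) * (u * (p₀ * (1 - s) * A)) ≤ ((1 - C) * lam ^ 2) * m₁ * (u * (p₀ * (1 - s) * A)) :=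
    mul_le_mul_of_nonneg_right (mul_le_mul_of_nonneg_left hm1' c0) c1
  have e4 : ((1 - C) * lam ^ 2) * m₁ * (u * (p₀ * (1 - s) * A)) = (1 - C) * lam ^ 2 * m₁ * u * (p₀ * (1 - s) * A) := by ring
  linarith [t, e1, e2, t2, e4]

/-- **Depth-0 part of (RC-G), scaled by p·p₀·ω·A.**  `N1s − Kas − HYs ≤ Kb(B′-part)s + R1s`, from the depth-0 chain
`k2_wpart_core`, `w ≤ 1−λ`, `(1−λ)(1+λ) ≤ 1` and CLAIM Z.
[cite: KozmaNitzan2024, Question 8 (§5.5 p. 36)] -/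
theorem rcg_k2_depth0 (lam A C s w u v m T' p q M₁ p₀ v₁ K₀ Yabs : ℝ)
    (hl0 : 0 < lam) (hl1 : lam < 1) (hA0 : 0 < A) (hA1 : A ≤ 1) (hC0 : 0 < C) (hC1 : C ≤ 1) (hlp : 0 ≤ (1 + lam) * C - 1)
    (hs0 : 0 ≤ s) (hs1 : s < 1) (hw0 : 0 ≤ w) (hw1 : w ≤ 1 - lam)
    (hu : 0 ≤ u) (hv : 0 ≤ v) (hm : 0 ≤ m) (hT : 0 ≤ T') (hsum : u + v + m + T' = 1)
    (hTu : ((1 + lam) * C - 1) * u ≤ T') (hvm : ((1 + lam) * C - 1) * m ≤ v)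
    (hp : p = u + v + m) (hq : q = (1 - s) * p + s * m) (hM : M₁ = A + C - A * C)
    (hp0 : p₀ = M₁ * q + s * C * u + s * A * v) (hv1 : v₁ = A * ((1 - C) * q + s * v))
    (hK : K₀ = lam * C * (1 - A) + M₁) (hY : Yabs = T' + (1 - A) * v - ((1 + lam) * C - 1) * (u + (1 - A) * m)) :
    w * v₁ * (1 - A) * ((1 + lam) * C - 1) * (p * (1 - s) * A) - w * v₁ * T' * K₀ * (p * (1 - s) * A)
      - s * w * v₁ * Yabs * (p * A)
      ≤ C * v * ((1 - A) * ((1 - C) * ((1 - s) + s * m) + s * v)) * (p₀ * (1 - s) * A)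
        + 3 / 4 * C * v * (1 - A) * (p₀ * (1 - s)) := by
  have hom : 0 ≤ 1 - s := by linarith
  have h1A : 0 ≤ 1 - A := by linarith
  have h1C : 0 ≤ 1 - C := by linarith
  have hp0' : 0 ≤ p := by rw [hp]; linarith
  have hp1 : p ≤ 1 := by rw [hp]; linarith
  have hq0 : 0 ≤ q := by rw [hq]; positivity
  have hCA' : 0 ≤ C * (1 - A) := mul_nonneg hC0.le h1A
  have hM0 : 0 ≤ M₁ := by rw [hM]; linarith
  have hsCu : 0 ≤ s * C * u := by positivity
  have hsAv : 0 ≤ s * A * v := by positivity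
  have hP0 : 0 ≤ p₀ := by rw [hp0]; have := mul_nonneg hM0 hq0; linarith
  have hBp0 : 0 ≤ (1 - C) * q + s * v := by positivity
  have hv10 : 0 ≤ v₁ := by rw [hv1]; exact mul_nonneg hA0.le hBp0
  have hYn : 0 ≤ Yabs := by
    have e : Yabs = (T' - ((1 + lam) * C - 1) * u) + (1 - A) * (v - ((1 + lam) * C - 1) * m) := by rw [hY]; ring
    have t : 0 ≤ (1 - A) * (v - ((1 + lam) * C - 1) * m) := mul_nonneg h1A (by linarith)
    linarith
  have hchain := k2_wpart_core lam A C s u v m T' Yabs hA0.le hA1 hs1.le (mul_nonneg hs0 hYn) hT hsum hTu hvm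
  have gv : 0 ≤ v₁ * p * A := mul_nonneg (mul_nonneg hv10 hp0') hA0.le
  have g0 : 0 ≤ w * (v₁ * p * A) := mul_nonneg hw0 gv
  have hB1 := mul_le_mul_of_nonneg_left hchain g0
  have f0 : 0 ≤ (1 - s) * (1 - A) * C * v := mul_nonneg (mul_nonneg (mul_nonneg hom h1A) hC0.le) hv
  have f1 : 0 ≤ (1 - s) * (1 - A) * (1 + lam) * C * v := by
    have : 0 ≤ (1 - s) * (1 - A) * (1 + lam) := mul_nonneg (mul_nonneg hom h1A) (by linarith)
    exact mul_nonneg (mul_nonneg this hC0.le) hv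
  have g1 : 0 ≤ (v₁ * p * A) * ((1 - s) * (1 - A) * (1 + lam) * C * v) := mul_nonneg gv f1
  have hB2 : w * ((v₁ * p * A) * ((1 - s) * (1 - A) * (1 + lam) * C * v))
      ≤ (1 - lam) * ((v₁ * p * A) * ((1 - s) * (1 - A) * (1 + lam) * C * v)) := mul_le_mul_of_nonneg_right hw1 g1
  have hC12 : 1 / 2 ≤ C := by
    have : (1 + lam) * C ≤ 2 * C := by nlinarith
    linarith
  have hZ := claimZ A C s u v m p q M₁ p₀ ((1 - C) * q + s * v) ((1 - C) * ((1 - s) + s * m) + s * v)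
    hA0 hA1 hC12 hC1 hs0 hs1.le hu hv hm hp hp1 hq hM hp0 rfl rfl
  have hZ' : A * p * v₁ ≤ A * p₀ * ((1 - C) * ((1 - s) + s * m) + s * v) + 3 / 4 * p₀ := by
    have e : A ^ 2 * p * ((1 - C) * q + s * v) = A * p * v₁ := by rw [hv1]; ring
    linarith [hZ, e]
  have hl2 : (1 - lam) * (1 + lam) ≤ 1 := by
    have e : (1 - lam) * (1 + lam) = 1 - lam ^ 2 := by ring
    have := sq_nonneg lam
    linarith
  have g2 : 0 ≤ A * p * v₁ := mul_nonneg (mul_nonneg hA0.le hp0') hv10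
  have t1 : ((1 - lam) * (1 + lam)) * (A * p * v₁) ≤ 1 * (A * p * v₁) := mul_le_mul_of_nonneg_right hl2 g2
  have t2 := mul_le_mul_of_nonneg_right t1 f0
  have t3 := mul_le_mul_of_nonneg_right hZ' f0
  have e1 : (1 - lam) * ((v₁ * p * A) * ((1 - s) * (1 - A) * (1 + lam) * C * v))
      = ((1 - lam) * (1 + lam)) * (A * p * v₁) * ((1 - s) * (1 - A) * C * v) := by ring
  have eL : w * v₁ * (1 - A) * ((1 + lam) * C - 1) * (p * (1 - s) * A) - w * v₁ * T' * K₀ * (p * (1 - s) * A)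
      - s * w * v₁ * Yabs * (p * A)
      = w * (v₁ * p * A) * ((1 - s) * ((1 - A) * ((1 + lam) * C - 1) - T' * (lam * C * (1 - A) + (A + C - A * C))) - s * Yabs) := by
    rw [hK, hM]; ring
  have eM : w * (v₁ * p * A) * ((1 - s) * (1 - A) * (1 + lam) * C * v) = w * ((v₁ * p * A) * ((1 - s) * (1 - A) * (1 + lam) * C * v)) := by ring
  have eR : (A * p₀ * ((1 - C) * ((1 - s) + s * m) + s * v) + 3 / 4 * p₀) * ((1 - s) * (1 - A) * C * v)
      = C * v * ((1 - A) * ((1 - C) * ((1 - s) + s * m) + s * v)) * (p₀ * (1 - s) * A) + 3 / 4 * C * v * (1 - A) * (p₀ * (1 - s)) := by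
    ring
  have e2 : 1 * (A * p * v₁) * ((1 - s) * (1 - A) * C * v) = (A * p * v₁) * ((1 - s) * (1 - A) * C * v) := by ring
  linarith [hB1, hB2, t2, t3, e1, eL, eM, eR, e2]

/-- **(RC-G), case A ≥ C — the universal k = 2 merge step, scaled by p·p₀·ω·A.**  Conclusion
`N1s + N3s ≤ Kas + Kbs + R1s + LLs + HYs` with
`N1s = w·v₁·(1−A)·λ′·(p·ω·A)`, `N3s = C·v·s·λ·(A−C)·u·(p₀·ω·A)`, `Kas = w·v₁·T′·K₀·(p·ω·A)`,
`Kbs = C·v·[sλC(1−A)m + ω(1−C)(1−A) + ωM₁T′ + s·Yabs]·(p₀·ω·A)`, `R1s = ¾·C·v·(1−A)·(p₀·ω)`,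
`LLs = (1−C)·λ²·m₁·u·(p₀·ω·A)`, `HYs = s·w·v₁·Yabs·(p·A)`; hypotheses = the reduced k = 2 data (FINDING-G31 §5b).
[cite: KozmaNitzan2024, Question 8 (§5.5 p. 36)] -/
theorem rcg_k2_caseAC (lam A C s w u v m T' p q M₁ p₀ v₁ m₁ K₀ Yabs : ℝ)
    (hl0 : 0 < lam) (hl1 : lam < 1) (hC0 : 0 < C) (hCA : C ≤ A) (hA1 : A ≤ 1) (hlp : 0 ≤ (1 + lam) * C - 1)
    (hs0 : 0 ≤ s) (hs1 : s < 1) (hw0 : 0 ≤ w) (hw1 : w ≤ 1 - lam)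
    (hu : 0 ≤ u) (hv : 0 ≤ v) (hm : 0 ≤ m) (hT : 0 ≤ T') (hsum : u + v + m + T' = 1)
    (hTu : ((1 + lam) * C - 1) * u ≤ T') (hvm : ((1 + lam) * C - 1) * m ≤ v) (hcheb : u * v ≤ T' * m)
    (hp : p = u + v + m) (hq : q = (1 - s) * p + s * m) (hM : M₁ = A + C - A * C)
    (hp0 : p₀ = M₁ * q + s * C * u + s * A * v) (hv1 : v₁ = A * ((1 - C) * q + s * v)) (hm1 : m₁ = A * C * q)
    (hK : K₀ = lam * C * (1 - A) + M₁) (hY : Yabs = T' + (1 - A) * v - ((1 + lam) * C - 1) * (u + (1 - A) * m)) :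
    w * v₁ * (1 - A) * ((1 + lam) * C - 1) * (p * (1 - s) * A) + C * v * s * lam * (A - C) * u * (p₀ * (1 - s) * A)
      ≤ w * v₁ * T' * K₀ * (p * (1 - s) * A)
        + C * v * (s * lam * C * (1 - A) * m + (1 - s) * (1 - C) * (1 - A) + (1 - s) * M₁ * T' + s * Yabs) * (p₀ * (1 - s) * A)
        + 3 / 4 * C * v * (1 - A) * (p₀ * (1 - s))
        + (1 - C) * lam ^ 2 * m₁ * u * (p₀ * (1 - s) * A)
        + s * w * v₁ * Yabs * (p * A) := by
  have hA0 : 0 < A := lt_of_lt_of_le hC0 hCA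
  have hC1 : C ≤ 1 := le_trans hCA hA1
  have h1 := rcg_k2_depth1 lam A C s u v m T' p q M₁ p₀ m₁ hl0 hl1 hC0 hCA hA1 hlp hs0 hs1 hu hv hm hT hTu hvm hcheb hp hq hM hp0 hm1
  have h0 := rcg_k2_depth0 lam A C s w u v m T' p q M₁ p₀ v₁ K₀ Yabs hl0 hl1 hA0 hA1 hC0 hC1 hlp hs0 hs1 hw0 hw1 hu hv hm hT hsum
    hTu hvm hp hq hM hp0 hv1 hK hY
  have hKb : C * v * (s * lam * C * (1 - A) * m + (1 - s) * (1 - C) * (1 - A) + (1 - s) * M₁ * T' + s * Yabs) * (p₀ * (1 - s) * A)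
      = C * v * ((1 - A) * ((1 - C) * ((1 - s) + s * m) + s * v)) * (p₀ * (1 - s) * A)
        + C * v * (((1 - s) * M₁ + s) * T' - s * ((1 + lam) * C - 1) * u) * (p₀ * (1 - s) * A) := by
    rw [hY]; ring
  rw [hKb]
  linarith [h1, h0]

/-- **(RC-G), case A ≤ C — the universal k = 2 merge step, scaled by p·p₀·ω·A.**  Here the depth-1 need N3 vanishes and
`Kbs` carries the extra non-negative term `s·λ·(C−A)·u`; the claim `N1s ≤ Kas + Kbs + R1s + LLs + HYs` follows from the
depth-0 part alone.  (The Chebyshev constraint is not needed in this case.)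
[cite: KozmaNitzan2024, Question 8 (§5.5 p. 36)] -/
theorem rcg_k2_caseCA (lam A C s w u v m T' p q M₁ p₀ v₁ m₁ K₀ Yabs : ℝ)
    (hl0 : 0 < lam) (hl1 : lam < 1) (hA0 : 0 < A) (hAC : A ≤ C) (hC1 : C ≤ 1) (hlp : 0 ≤ (1 + lam) * C - 1)
    (hs0 : 0 ≤ s) (hs1 : s < 1) (hw0 : 0 ≤ w) (hw1 : w ≤ 1 - lam)
    (hu : 0 ≤ u) (hv : 0 ≤ v) (hm : 0 ≤ m) (hT : 0 ≤ T') (hsum : u + v + m + T' = 1)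
    (hTu : ((1 + lam) * C - 1) * u ≤ T') (hvm : ((1 + lam) * C - 1) * m ≤ v)
    (hp : p = u + v + m) (hq : q = (1 - s) * p + s * m) (hM : M₁ = A + C - A * C)
    (hp0 : p₀ = M₁ * q + s * C * u + s * A * v) (hv1 : v₁ = A * ((1 - C) * q + s * v)) (hm1 : m₁ = A * C * q)
    (hK : K₀ = lam * C * (1 - A) + M₁) (hY : Yabs = T' + (1 - A) * v - ((1 + lam) * C - 1) * (u + (1 - A) * m)) :
    w * v₁ * (1 - A) * ((1 + lam) * C - 1) * (p * (1 - s) * A)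
      ≤ w * v₁ * T' * K₀ * (p * (1 - s) * A)
        + C * v * (s * lam * C * (1 - A) * m + (1 - s) * (1 - C) * (1 - A) + (1 - s) * M₁ * T' + s * lam * (C - A) * u + s * Yabs)
            * (p₀ * (1 - s) * A)
        + 3 / 4 * C * v * (1 - A) * (p₀ * (1 - s))
        + (1 - C) * lam ^ 2 * m₁ * u * (p₀ * (1 - s) * A)
        + s * w * v₁ * Yabs * (p * A) := by
  have hC0 : 0 < C := lt_of_lt_of_le hA0 hAC
  have hA1 : A ≤ 1 := le_trans hAC hC1
  have hom : 0 ≤ 1 - s := by linarith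
  have h1C : 0 ≤ 1 - C := by linarith
  have hp0' : 0 ≤ p := by rw [hp]; linarith
  have hq0 : 0 ≤ q := by rw [hq]; positivity
  have hCA' : 0 ≤ C * (1 - A) := mul_nonneg hC0.le (by linarith)
  have hM0 : 0 ≤ M₁ := by rw [hM]; linarith
  have hsCu : 0 ≤ s * C * u := by positivity
  have hsAv : 0 ≤ s * A * v := by positivity
  have hP0 : 0 ≤ p₀ := by rw [hp0]; have := mul_nonneg hM0 hq0; linarith
  have h0 := rcg_k2_depth0 lam A C s w u v m T' p q M₁ p₀ v₁ K₀ Yabs hl0 hl1 hA0 hA1 hC0 hC1 hlp hs0 hs1 hw0 hw1 hu hv hm hT hsum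
    hTu hvm hp hq hM hp0 hv1 hK hY
  -- the unused parts of Kbs and LLs are non-negative
  have r0 : 0 ≤ ((1 - s) * M₁ + s) * T' - s * ((1 + lam) * C - 1) * u + s * lam * (C - A) * u := by
    have t1 : s * (((1 + lam) * C - 1) * u) ≤ s * T' := mul_le_mul_of_nonneg_left hTu hs0
    have t2 : 0 ≤ (1 - s) * M₁ * T' := by positivity
    have t3 : 0 ≤ s * lam * (C - A) * u := by
      have : 0 ≤ C - A := by linarith
      positivity
    nlinarith [t1, t2, t3]
  have r1 : 0 ≤ C * v * (((1 - s) * M₁ + s) * T' - s * ((1 + lam) * C - 1) * u + s * lam * (C - A) * u) * (p₀ * (1 - s) * A) := by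
    have : 0 ≤ C * v := mul_nonneg hC0.le hv
    have : 0 ≤ p₀ * (1 - s) * A := by positivity
    positivity
  have r2 : 0 ≤ (1 - C) * lam ^ 2 * m₁ * u * (p₀ * (1 - s) * A) := by
    have : 0 ≤ m₁ := by rw [hm1]; positivity
    positivity
  have hKb : C * v * (s * lam * C * (1 - A) * m + (1 - s) * (1 - C) * (1 - A) + (1 - s) * M₁ * T' + s * lam * (C - A) * u + s * Yabs)
        * (p₀ * (1 - s) * A)
      = C * v * ((1 - A) * ((1 - C) * ((1 - s) + s * m) + s * v)) * (p₀ * (1 - s) * A)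
        + C * v * (((1 - s) * M₁ + s) * T' - s * ((1 + lam) * C - 1) * u + s * lam * (C - A) * u) * (p₀ * (1 - s) * A) := by
    rw [hY]; ring
  rw [hKb]
  linarith [h0, r1, r2]

end PocketCert

end Summit.CriticalPhenomena.PercolationContinuityZ3.Theorems
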